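import Literature.NumberTheory.EllipticCurves.EisensteinNewformLevelRaisingOddAssemblyProofs
import Literature.NumberTheory.EllipticCurves.HeckeOperatorsDiamondCommProofs
import Literature.NumberTheory.EllipticCurves.Gamma1NewformLSeriesFrickeProofs
import HarnessLib

/-!
# Billerey–Menares 2016, Thm. 2.2 at every odd prime: the exact-nebentypus cuspidal lift of the
# level-raised Eisenstein series from integral forms with an indicator constant term (proofs only)

Topic `Literature/NumberTheory/EllipticCurves`; namespace `Literature.NumberTheory.EllipticCurves`
(helpers in `Literature.NumberTheory.EllipticCurves.ModularForms.CuspFormLift`).  THEOREMS ONLY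
(no definition of a notion, no named fact; D-0026).

The one step of the printed proof of Billerey–Menares 2016, Thm. 2.2 (Math. Res. Lett. 23, §2,
p. 7: "the reduction `F` of `E` modulo `λ` is a cuspidal eigenform … we can find a form
`f ∈ S_k(Γ₀(Np), ε₀)`") that the tree does not have is the hypothesis `hC` of
`BillereyMenares2016_thm22_exists_newform_odd_of_cuspidalCongruence`
(`EisensteinNewformLevelRaisingOddAssemblyProofs`): a cusp form `f₀ ∈ S_k(NM, χ)` WITH THE EXACT
NEBENTYPUS `χ` congruent to `E = eisensteinLevelRaised N k χ M = E_k^{𝟙,χ} - E_k^{𝟙,χ}(M·)`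
modulo the maximal ideal of `𝒪_{ℚ̄_p}`, given that all constant terms of `E` lie in that ideal.
Here we prove `hC` — for EVERY odd prime `p`, including `p ∣ φ(NM)` and `p = 3` — from the
geometric input in its weakest classical form, the statement
`Edixhoven1997_exists_integralForm_cuspIndicator` (to be recorded in
`ModularFormsIntegralCuspIndicator.lean`; B. Edixhoven, *Serre's conj.*, in
Cornell–Silverman–Stevens 1997, Lemma 1.9 and its proof: `H¹(X₁(L)_{ℤ_p}, ω^{⊗k}(-cusps)) = 0` for
`k ≥ 3`, whence the constant-term map `M_k(Γ₁(L); 𝒪) → ⊕_{cusps} 𝒪` is onto; Katz 1973 §1.6–1.7),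
taken as the explicit hypothesis `hX` (spelled out verbatim): for `p ∤ L`, `k ≥ 3` and a cusp
`γ₀∞` of `X₁(L)` there is `H ∈ M_k(Γ₁(L))` with `p`-integral `q`-expansions along `Γ₀(L)` and
constant terms the indicator of the `Γ₁(L)`-class of `γ₀∞`.

Mathematical content (new; replaces the Carayol-lemma route of Billerey–Menares 2018, §3.2,
which is not available for `p = 3` or `p ∣ φ(NM)`).  Let `L = NM`, `γ₁ = (1 0; N 1)`, and let
`H` be the form of `hX` at the cusp `γ₁∞ = 1/N`.  Average over `Γ₀(L)/Γ₁(L) ≅ (ℤ/L)ˣ`: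
`H_χ := ∑_d χ̄(d) H ∣[k] σ_d` (`σ_d ∈ Γ₀(L)` with lower-right entry `d`) is a modular form on
`Γ₁(L)` with `H_χ ∣[k] γ = χ(d_γ) H_χ` on `Γ₀(L)` and `p`-integral `q`-expansion (a sum of
`p`-integral ones).  Its constant terms: `H ∣[k] σ_dγ → 1` exactly when
`σ_d γ T^j γ₁⁻¹ ∈ Γ₁(L)` for some `j`, i.e. when `X_j := γ T^j γ₁⁻¹ ∈ Γ₀(L)` and
`d · (X_j)₁₁ ≡ 1`; now `X_j ∈ Γ₀(L)` for some `j` iff `N ∣ c_γ` and `M ∤ c_γ`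
(`(X_j)₁₀ = c - N(cj + d_γ)`), the residue `(X_j)₁₁ = cj + d_γ (mod L)` does not depend on the
admissible `j`, and `χ(cj + d_γ) = χ(d_γ)` as `N ∣ c`; the branch `-σ_dγT^jγ₁⁻¹ ∈ Γ₁(L)`
contributes `χ(-1)(-1)^k χ(d_γ) = χ(d_γ)`.  Hence `H_χ ∣[k] γ → 2χ(d_γ)` if `N ∣ c_γ`, `M ∤ c_γ`,
and `→ 0` otherwise — the same support and the same `Γ₀(L)`-equivariance as the constant terms
`c₁ χ(d_γ)` of `E` (`tendsto_eisensteinLevelRaised_slash_atImInfty_of_dvd/_of_isCoprime`,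
`c₁ = -(B_{k,χ}/4k)(1 + χ(-1)(-1)^k)(1 - χ̄(M)M^{-k})`, which lies in `𝔪` by hypothesis at
`γ = γ₁`).  So `f₀ := E - (c₁/2) H_χ` is a CUSP form, of nebentypus `χ` exactly, and
`aₙ(f₀) - aₙ(E) = -(c₁/2) aₙ(H_χ) ∈ 𝔪` (`p ≠ 2`).  (Equivalently: for `k ≥ 3` the sequence
`0 → S_k(Γ₁(L); 𝒪) → M_k(Γ₁(L); 𝒪) → 𝒪[cusps] → 0` is exact and SPLITS over `𝒪[(ℤ/L)ˣ]`, the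
cusps having stabilisers of order prime to `p`; no lifting of mod-`p` forms with character, hence
no Carayol lemma, is involved.)

* `ModularForms.CuspFormLift.exists_cuspForm_nebentypus_congr_eisensteinLevelRaised` — `hX ⟹ hC`.
* `BillereyMenares2016_thm22_exists_newform_odd_of_integralCuspIndicator` — `hX ⟹` the named fact
  `BillereyMenares2016_thm22_exists_newform_odd` (all odd `p`).
* `BillereyMenares2016_thm22_exists_newform_of_integralCuspIndicator` — `hX ⟹` the named fact
  `BillereyMenares2016_thm22_exists_newform` (`p ≥ 5`).

## References

* N. Billerey, R. Menares, *On the modularity of reducible mod `l` Galois representations*, Math.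
  Res. Lett. 23 (2016), 15–41, §2, Thm. 2.2 and its proof (p. 7), Prop. 1.2. [BillereyMenares2016]
* B. Edixhoven, in: Modular Forms and Fermat's Last Theorem (Cornell, Silverman, Stevens eds.),
  Springer 1997, Ch. VII, Lemma 1.9 (and proof), Prop. 1.10. [Edixhoven1997]
* N. M. Katz, *p-adic properties of modular schemes and modular forms*, LNM 350 (1973), §1.6–1.7.
  [Katz1973]
-/

noncomputable section

open scoped MatrixGroups ModularForm Topology
open CongruenceSubgroup UpperHalfPlane Filter Matrix.SpecialLinearGroup ConjAct Pointwise

namespace Literature.NumberTheory.EllipticCurves.ModularForms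

namespace CuspFormLift

/-! ### Translates of modular forms on `Γ₁(L)` by `Γ₀(L)` -/

section Translate

variable {L : ℕ} {k : ℤ}

/-- `F ∣[k] σ` for `σ ∈ Γ₀(L)` is again a modular form on `Γ₁(L)` (`Γ₁(L) ◁ Γ₀(L)`; Mathlib's
`ModularForm.translate` transported along `σ⁻¹ Γ₁(L) σ = Γ₁(L)`). [folklore] -/
theorem exists_modularForm_coe_eq_slash (F : ModularForm (Gamma1 L) k) (σ : Gamma0 L) :
    ∃ G : ModularForm (Gamma1 L) k, (⇑G : ℍ → ℂ) = (⇑F : ℍ → ℂ) ∣[k] ((σ : SL(2, ℤ))) := by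
  refine ⟨(ModularForm.translate F (mapGL ℝ (σ : SL(2, ℤ)))).copy
    ((⇑F : ℍ → ℂ) ∣[k] (mapGL ℝ (σ : SL(2, ℤ)))) rfl
    (by rw [← map_inv, conj_Gamma1_eq L (inv_mem σ.2)]), ?_⟩
  rw [ModularForm.SL_slash]; rfl

/-- Two elements of `Γ₀(L)` with the same lower-right entry mod `L` translate a form on `Γ₁(L)`
identically (`x y⁻¹ ∈ Γ₁(L)`). [folklore] -/
theorem slash_eq_of_gamma0Map_eq (F : ModularForm (Gamma1 L) k) {x y : Gamma0 L}
    (h : Gamma0Map L x = Gamma0Map L y) :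
    (⇑F : ℍ → ℂ) ∣[k] ((x : SL(2, ℤ))) = (⇑F : ℍ → ℂ) ∣[k] ((y : SL(2, ℤ))) := by
  have hmem : ((x * y⁻¹ : Gamma0 L) : SL(2, ℤ)) ∈ Gamma1 L :=
    mem_gamma1_of_gamma0Map_eq_one L (by rw [map_mul, h, ← map_mul, mul_inv_cancel, map_one])
  have hx : (x : SL(2, ℤ)) = ((x * y⁻¹ : Gamma0 L) : SL(2, ℤ)) * (y : SL(2, ℤ)) := by simp
  have hF : (⇑F : ℍ → ℂ) ∣[k] (((x * y⁻¹ : Gamma0 L) : SL(2, ℤ))) = ⇑F := by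
    rw [ModularForm.SL_slash]
    exact SlashInvariantFormClass.slash_action_eq F _ ⟨_, hmem, rfl⟩
  rw [hx, SlashAction.slash_mul, hF]

end Translate

/-! ### The `χ`-average over `Γ₀(L)/Γ₁(L)` -/

section Average

variable {L : ℕ} [NeZero L] {k : ℤ}

/-- **The `χ`-average** `H_χ = ∑_{d ∈ (ℤ/L)ˣ} χ(d)⁻¹ • H ∣[k] σ_d` (`σ_d ∈ Γ₀(L)` any matrices
indexed by `(ℤ/L)ˣ`) of a modular form `H` on `Γ₁(L)` is a modular form on `Γ₁(L)`. [folklore] -/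
theorem exists_modularForm_coe_eq_average (χ : DirichletCharacter ℂ L) (H : ModularForm (Gamma1 L) k)
    (σ : (ZMod L)ˣ → Gamma0 L) :
    ∃ G : ModularForm (Gamma1 L) k, (⇑G : ℍ → ℂ) =
      ∑ d : (ZMod L)ˣ, (χ (d : ZMod L))⁻¹ • ((⇑H : ℍ → ℂ) ∣[k] ((σ d : SL(2, ℤ)))) := by
  choose G hG using fun d : (ZMod L)ˣ ↦ exists_modularForm_coe_eq_slash H (σ d)
  refine ⟨∑ d : (ZMod L)ˣ, (χ (d : ZMod L))⁻¹ • G d, ?_⟩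
  change ModularForm.coeHom (∑ d : (ZMod L)ˣ, (χ (d : ZMod L))⁻¹ • G d) = _
  rw [map_sum]
  refine Finset.sum_congr rfl fun d _ ↦ ?_
  change (⇑((χ (d : ZMod L))⁻¹ • G d) : ℍ → ℂ) = _
  rw [ModularForm.IsGLPos.coe_smul, hG]

omit [NeZero L] in
/-- A Dirichlet character does not vanish on units. [folklore] -/
theorem dirichlet_apply_units_ne_zero (χ : DirichletCharacter ℂ L) (u : (ZMod L)ˣ) :
    χ (u : ZMod L) ≠ 0 := fun h ↦ by
  have := χ.map_one
  rw [← u.mul_inv, map_mul, h, zero_mul] at this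
  exact zero_ne_one this

/-- **`H_χ` has nebentypus `χ`**: `H_χ ∣[k] γ = χ(d_γ) H_χ` for `γ ∈ Γ₀(L)`, provided the lower-right
entry of `σ_d` is `d`. [folklore] -/
theorem average_slash (χ : DirichletCharacter ℂ L) (H : ModularForm (Gamma1 L) k)
    {σ : (ZMod L)ˣ → Gamma0 L} (hσ : ∀ d, Gamma0Map L (σ d) = (d : ZMod L)) (γ : Gamma0 L) :
    (∑ d : (ZMod L)ˣ, (χ (d : ZMod L))⁻¹ • ((⇑H : ℍ → ℂ) ∣[k] ((σ d : SL(2, ℤ))))) ∣[k]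
        ((γ : SL(2, ℤ))) =
      χ (Gamma0Map L γ) •
        ∑ d : (ZMod L)ˣ, (χ (d : ZMod L))⁻¹ • ((⇑H : ℍ → ℂ) ∣[k] ((σ d : SL(2, ℤ)))) := by
  set u : (ZMod L)ˣ := (isUnit_Gamma0Map L γ).unit with hu
  have hu' : (u : ZMod L) = Gamma0Map L γ := rfl
  rw [SlashAction.sum_slash, Finset.smul_sum]
  -- `(H ∣ σ_d) ∣ γ = H ∣ σ_{d u}`
  have hterm : ∀ d : (ZMod L)ˣ,
      ((χ (d : ZMod L))⁻¹ • ((⇑H : ℍ → ℂ) ∣[k] ((σ d : SL(2, ℤ))))) ∣[k] ((γ : SL(2, ℤ))) =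
        (χ (d : ZMod L))⁻¹ • ((⇑H : ℍ → ℂ) ∣[k] ((σ (d * u) : SL(2, ℤ)))) := by
    intro d
    rw [ModularForm.SL_smul_slash, ← SlashAction.slash_mul]
    congr 1
    have h1 : ((σ d : SL(2, ℤ)) * (γ : SL(2, ℤ))) = ((σ d * γ : Gamma0 L) : SL(2, ℤ)) := rfl
    rw [h1]
    refine slash_eq_of_gamma0Map_eq H ?_
    rw [map_mul, hσ, hσ, Units.val_mul, hu']
  simp_rw [hterm]
  -- reindex `d ↦ d u`
  refine Fintype.sum_equiv (Equiv.mulRight u) _ _ fun d ↦ ?_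
  rw [Equiv.coe_mulRight, smul_smul, Units.val_mul, map_mul, mul_inv, ← hu']
  congr 1
  have := dirichlet_apply_units_ne_zero χ u
  field_simp

end Average

/-! ### The cusps `Γ₁(NM) γ₁ T^ℤ`, `γ₁ = (1 0; N 1)`: which `γ T^j γ₁⁻¹` lie in `Γ₀(NM)` -/

section Cusps

variable {N M : ℕ}

/-- Entries of `X_j = γ T^j γ₁⁻¹`, `γ₁ = (1 0; N 1)`: lower-left `c - N(cj + d)`, lower-right
`cj + d`. [folklore] -/
theorem X_entries (γ γ₁ : SL(2, ℤ)) (hγ₁ : (γ₁ : Matrix (Fin 2) (Fin 2) ℤ) = !![1, 0; (N : ℤ), 1])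
    (j : ℤ) :
    (γ * ModularGroup.T ^ j * γ₁⁻¹) 1 0 = γ 1 0 - N * (γ 1 0 * j + γ 1 1) ∧
      (γ * ModularGroup.T ^ j * γ₁⁻¹) 1 1 = γ 1 0 * j + γ 1 1 := by
  have hinv : ((γ₁⁻¹ : SL(2, ℤ)) : Matrix (Fin 2) (Fin 2) ℤ) = !![1, 0; -(N : ℤ), 1] := by
    rw [Matrix.SpecialLinearGroup.coe_inv, hγ₁, Matrix.adjugate_fin_two]
    ext i j'
    fin_cases i <;> fin_cases j' <;> simp
  refine ⟨?_, ?_⟩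
  · simp [Matrix.SpecialLinearGroup.coe_mul, hinv, ModularGroup.coe_T_zpow, Matrix.mul_apply,
      Fin.sum_univ_two]
    ring
  · simp [Matrix.SpecialLinearGroup.coe_mul, hinv, ModularGroup.coe_T_zpow, Matrix.mul_apply,
      Fin.sum_univ_two]

/-- If some `X_j = γ T^j γ₁⁻¹` lies in `Γ₀(NM)` then `N ∣ c_γ` and `M ∤ c_γ` (`M` prime,
`gcd(M, N) = 1`). [folklore] -/
theorem dvd_and_not_dvd_of_X_mem (hM : M.Prime) (hMN : M.Coprime N) {γ γ₁ : SL(2, ℤ)}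
    (hγ₁ : (γ₁ : Matrix (Fin 2) (Fin 2) ℤ) = !![1, 0; (N : ℤ), 1]) {j : ℤ}
    (hX : γ * ModularGroup.T ^ j * γ₁⁻¹ ∈ Gamma0 (N * M)) :
    (N : ℤ) ∣ γ 1 0 ∧ ¬ (M : ℤ) ∣ γ 1 0 := by
  rw [Gamma0_mem, (X_entries γ γ₁ hγ₁ j).1, ZMod.intCast_zmod_eq_zero_iff_dvd, Nat.cast_mul] at hX
  have hN : (N : ℤ) ∣ γ 1 0 := by
    have h1 : (N : ℤ) ∣ γ 1 0 - N * (γ 1 0 * j + γ 1 1) := (dvd_mul_right _ _).trans hX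
    have h2 : (N : ℤ) ∣ N * (γ 1 0 * j + γ 1 1) := dvd_mul_right _ _
    simpa using dvd_add h1 h2
  refine ⟨hN, fun hMc ↦ ?_⟩
  have h1 : (M : ℤ) ∣ γ 1 0 - N * (γ 1 0 * j + γ 1 1) := (dvd_mul_left _ _).trans hX
  have h2 : (M : ℤ) ∣ N * (γ 1 0 * j + γ 1 1) := by
    have := dvd_sub hMc h1
    simpa using this
  have h3 : (M : ℤ) ∣ γ 1 0 * j + γ 1 1 := by
    have hcop : IsCoprime (M : ℤ) (N : ℤ) := by
      rw [Int.isCoprime_iff_gcd_eq_one, Int.gcd_natCast_natCast]; exact hMN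
    exact hcop.dvd_of_dvd_mul_left h2
  have h4 : (M : ℤ) ∣ γ 1 1 := by
    have := dvd_sub h3 (hMc.mul_right j)
    simpa using this
  have hdet := Matrix.SpecialLinearGroup.det_coe γ
  rw [Matrix.det_fin_two] at hdet
  have h5 : (M : ℤ) ∣ 1 := by
    rw [← hdet]
    exact dvd_sub (h4.mul_left _) (hMc.mul_left _)
  have hM1 : (M : ℤ) = 1 ∨ (M : ℤ) = -1 := by
    rcases Int.isUnit_iff.mp (isUnit_of_dvd_one h5) with h | h
    · exact Or.inl h
    · exact Or.inr h
  rcases hM1 with h | h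
  · exact hM.one_lt.ne' (by exact_mod_cast h)
  · have : (0 : ℤ) ≤ M := Int.natCast_nonneg M
    omega

/-- Conversely, if `N ∣ c_γ` and `M ∤ c_γ` then some `X_j = γ T^j γ₁⁻¹` lies in `Γ₀(NM)`. [folklore] -/
theorem exists_X_mem (hM : M.Prime) (hMN : M.Coprime N) {γ γ₁ : SL(2, ℤ)}
    (hγ₁ : (γ₁ : Matrix (Fin 2) (Fin 2) ℤ) = !![1, 0; (N : ℤ), 1])
    (hN : (N : ℤ) ∣ γ 1 0) (hMc : ¬ (M : ℤ) ∣ γ 1 0) :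
    ∃ j : ℤ, γ * ModularGroup.T ^ j * γ₁⁻¹ ∈ Gamma0 (N * M) := by
  haveI := Fact.mk hM
  obtain ⟨c', hc'⟩ := hN
  have hMc' : ((c' : ℤ) : ZMod M) ≠ 0 := by
    rw [Ne, ZMod.intCast_zmod_eq_zero_iff_dvd]
    rintro ⟨e, he⟩
    exact hMc ⟨N * e, by rw [hc', he]; ring⟩
  have hNM : (N : ZMod M) ≠ 0 := by
    rw [Ne, ZMod.natCast_eq_zero_iff]
    intro h
    exact hM.one_lt.ne' (Nat.Coprime.eq_one_of_dvd hMN h)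
  set t : ZMod M := ((c' : ZMod M) - (γ 1 1 : ℤ)) * ((N : ZMod M) * (c' : ZMod M))⁻¹ with ht
  refine ⟨(t.val : ℤ), ?_⟩
  rw [Gamma0_mem, (X_entries γ γ₁ hγ₁ _).1, hc', ZMod.intCast_zmod_eq_zero_iff_dvd, Nat.cast_mul]
  -- `N(c' - N c' t - d) ≡ 0 (mod NM)`: enough `c' - N c' t - d ≡ 0 (mod M)`
  have key : ((c' - (N * c' * (t.val : ℤ) + γ 1 1) : ℤ) : ZMod M) = 0 := by
    push_cast
    rw [ZMod.natCast_zmod_val, ht]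
    field_simp
    ring
  rw [ZMod.intCast_zmod_eq_zero_iff_dvd] at key
  obtain ⟨e, he⟩ := key
  refine ⟨e, ?_⟩
  have : (N : ℤ) * c' - N * (N * c' * (t.val : ℤ) + γ 1 1) =
      N * (c' - (N * c' * (t.val : ℤ) + γ 1 1)) := by
    ring
  rw [this, he]
  ring

/-- The lower-right residue `(X_j)₁₁ (mod NM)` is the same for all admissible `j`. [folklore] -/
theorem X_apply_one_one_eq (hM : M.Prime) (hMN : M.Coprime N) {γ γ₁ : SL(2, ℤ)}
    (hγ₁ : (γ₁ : Matrix (Fin 2) (Fin 2) ℤ) = !![1, 0; (N : ℤ), 1]) {j j' : ℤ}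
    (hX : γ * ModularGroup.T ^ j * γ₁⁻¹ ∈ Gamma0 (N * M))
    (hX' : γ * ModularGroup.T ^ j' * γ₁⁻¹ ∈ Gamma0 (N * M)) :
    (((γ * ModularGroup.T ^ j * γ₁⁻¹) 1 1 : ℤ) : ZMod (N * M)) =
      (((γ * ModularGroup.T ^ j' * γ₁⁻¹) 1 1 : ℤ) : ZMod (N * M)) := by
  have hMc := (dvd_and_not_dvd_of_X_mem hM hMN hγ₁ hX).2
  obtain ⟨c', hc'⟩ := (dvd_and_not_dvd_of_X_mem hM hMN hγ₁ hX).1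
  rw [Gamma0_mem, (X_entries γ γ₁ hγ₁ _).1, ZMod.intCast_zmod_eq_zero_iff_dvd, Nat.cast_mul] at hX hX'
  rw [(X_entries γ γ₁ hγ₁ _).2, (X_entries γ γ₁ hγ₁ _).2, ZMod.intCast_eq_intCast_iff_dvd_sub,
    Nat.cast_mul]
  -- `NM ∣ N c (j' - j)` hence `M ∣ j' - j` hence `NM ∣ c (j - j')`
  have h1 : ((N : ℤ) * M) ∣ (N : ℤ) * (γ 1 0 * (j' - j)) := by
    have := dvd_sub hX hX'
    have e : γ 1 0 - N * (γ 1 0 * j + γ 1 1) - (γ 1 0 - N * (γ 1 0 * j' + γ 1 1)) =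
        N * (γ 1 0 * (j' - j)) := by ring
    rwa [e] at this
  have hN0 : (N : ℤ) ≠ 0 := by
    rintro h
    rw [h, zero_mul] at hc'
    exact hMc (hc' ▸ dvd_zero _)
  have h2 : (M : ℤ) ∣ γ 1 0 * (j' - j) := (mul_dvd_mul_iff_left hN0).mp h1
  have hprime : Prime (M : ℤ) := Nat.prime_iff_prime_int.mp hM
  have h3 : (M : ℤ) ∣ j' - j := by
    rcases hprime.dvd_or_dvd h2 with h | h
    · exact absurd h hMc
    · exact h
  obtain ⟨e, he⟩ := h3
  refine ⟨c' * e, ?_⟩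
  have : γ 1 0 * j' + γ 1 1 - (γ 1 0 * j + γ 1 1) = γ 1 0 * (j' - j) := by ring
  rw [this, he, hc']
  ring

end Cusps

/-! ### Membership of `σ_d X` and `-σ_d X` in `Γ₁(L)` -/

section Membership

variable {L : ℕ}

/-- Entries `(1,0)` and `(1,1)` of a product in `SL₂(ℤ)`. [folklore] -/
theorem mul_apply_one (A X : SL(2, ℤ)) :
    ((A * X) 1 0 : ℤ) = A 1 0 * X 0 0 + A 1 1 * X 1 0 ∧
      ((A * X) 1 1 : ℤ) = A 1 0 * X 0 1 + A 1 1 * X 1 1 := by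
  constructor <;> simp [Matrix.SpecialLinearGroup.coe_mul, Matrix.mul_apply, Fin.sum_univ_two]

/-- `Y ∈ Γ₁(L)` iff `Y₁₀ ≡ 0` and `Y₁₁ ≡ 1` (the condition `Y₀₀ ≡ 1` follows from `det Y = 1`). [folklore] -/
theorem mem_Gamma1_iff_two (Y : SL(2, ℤ)) :
    Y ∈ Gamma1 L ↔ ((Y 1 0 : ℤ) : ZMod L) = 0 ∧ ((Y 1 1 : ℤ) : ZMod L) = 1 := by
  rw [Gamma1_mem]
  constructor
  · rintro ⟨-, h11, h10⟩
    exact ⟨h10, h11⟩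
  · rintro ⟨h10, h11⟩
    refine ⟨?_, h11, h10⟩
    have hdet := Matrix.SpecialLinearGroup.det_coe Y
    rw [Matrix.det_fin_two] at hdet
    have h := congrArg (fun z : ℤ ↦ (z : ZMod L)) hdet
    simp only [Int.cast_sub, Int.cast_mul, Int.cast_one, h10, h11, mul_one, mul_zero, sub_zero] at h
    exact h

/-- `-Y ∈ Γ₁(L)` iff `Y₁₀ ≡ 0` and `Y₁₁ ≡ -1`. [folklore] -/
theorem neg_mem_Gamma1_iff_two (Y : SL(2, ℤ)) :
    -Y ∈ Gamma1 L ↔ ((Y 1 0 : ℤ) : ZMod L) = 0 ∧ ((Y 1 1 : ℤ) : ZMod L) = -1 := by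
  rw [mem_Gamma1_iff_two]
  have h10 : ((-Y : SL(2, ℤ)) 1 0 : ℤ) = -(Y 1 0) := by simp [Matrix.SpecialLinearGroup.coe_neg]
  have h11 : ((-Y : SL(2, ℤ)) 1 1 : ℤ) = -(Y 1 1) := by simp [Matrix.SpecialLinearGroup.coe_neg]
  rw [h10, h11, Int.cast_neg, Int.cast_neg, neg_eq_zero, neg_eq_iff_eq_neg]

/-- **`σ X ∈ Γ₁(L)` for `σ ∈ Γ₀(L)` with lower-right entry `d`** iff `X ∈ Γ₀(L)` and
`d · X₁₁ ≡ 1`. [folklore] -/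
theorem gamma0_mul_mem_Gamma1_iff (σ : Gamma0 L) (X : SL(2, ℤ)) :
    (σ : SL(2, ℤ)) * X ∈ Gamma1 L ↔
      X ∈ Gamma0 L ∧ Gamma0Map L σ * ((X 1 1 : ℤ) : ZMod L) = 1 := by
  have hσ10 : (((σ : SL(2, ℤ)) 1 0 : ℤ) : ZMod L) = 0 := Gamma0_mem.mp σ.2
  have hσ11 : (((σ : SL(2, ℤ)) 1 1 : ℤ) : ZMod L) = Gamma0Map L σ := rfl
  have e10 : ((((σ : SL(2, ℤ)) * X) 1 0 : ℤ) : ZMod L) = Gamma0Map L σ * ((X 1 0 : ℤ) : ZMod L) := by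
    rw [(mul_apply_one _ X).1]; push_cast; rw [hσ10, hσ11]; ring
  have e11 : ((((σ : SL(2, ℤ)) * X) 1 1 : ℤ) : ZMod L) = Gamma0Map L σ * ((X 1 1 : ℤ) : ZMod L) := by
    rw [(mul_apply_one _ X).2]; push_cast; rw [hσ10, hσ11]; ring
  rw [mem_Gamma1_iff_two, Gamma0_mem, e10, e11]
  have hu : IsUnit (Gamma0Map L σ) := isUnit_Gamma0Map L σ
  constructor
  · rintro ⟨h10, h11⟩
    exact ⟨(hu.mul_right_eq_zero).mp h10, h11⟩
  · rintro ⟨h10, h11⟩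
    exact ⟨by rw [h10, mul_zero], h11⟩

/-- **`-σ X ∈ Γ₁(L)`** iff `X ∈ Γ₀(L)` and `d · X₁₁ ≡ -1`. [folklore] -/
theorem neg_gamma0_mul_mem_Gamma1_iff (σ : Gamma0 L) (X : SL(2, ℤ)) :
    -((σ : SL(2, ℤ)) * X) ∈ Gamma1 L ↔
      X ∈ Gamma0 L ∧ Gamma0Map L σ * ((X 1 1 : ℤ) : ZMod L) = -1 := by
  have hσ10 : (((σ : SL(2, ℤ)) 1 0 : ℤ) : ZMod L) = 0 := Gamma0_mem.mp σ.2
  have hσ11 : (((σ : SL(2, ℤ)) 1 1 : ℤ) : ZMod L) = Gamma0Map L σ := rfl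
  have e10 : ((((σ : SL(2, ℤ)) * X) 1 0 : ℤ) : ZMod L) = Gamma0Map L σ * ((X 1 0 : ℤ) : ZMod L) := by
    rw [(mul_apply_one _ X).1]; push_cast; rw [hσ10, hσ11]; ring
  have e11 : ((((σ : SL(2, ℤ)) * X) 1 1 : ℤ) : ZMod L) = Gamma0Map L σ * ((X 1 1 : ℤ) : ZMod L) := by
    rw [(mul_apply_one _ X).2]; push_cast; rw [hσ10, hσ11]; ring
  rw [neg_mem_Gamma1_iff_two, Gamma0_mem, e10, e11]
  have hu : IsUnit (Gamma0Map L σ) := isUnit_Gamma0Map L σ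
  constructor
  · rintro ⟨h10, h11⟩
    exact ⟨(hu.mul_right_eq_zero).mp h10, h11⟩
  · rintro ⟨h10, h11⟩
    exact ⟨by rw [h10, mul_zero], h11⟩

end Membership

/-! ### The indicator sums `∑_d χ(d)⁻¹ [∃ j, …]` -/

section IndicatorSum

variable {N M : ℕ} [NeZero (N * M)]

/-- `χ_L(u⁻¹)⁻¹ = χ_L(u)` on units. [folklore] -/
theorem dirichlet_apply_inv_units_inv {L : ℕ} (ψ : DirichletCharacter ℂ L) (u : (ZMod L)ˣ) :
    (ψ ((u⁻¹ : (ZMod L)ˣ) : ZMod L))⁻¹ = ψ (u : ZMod L) := by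
  have h : ψ ((u⁻¹ : (ZMod L)ˣ) : ZMod L) * ψ (u : ZMod L) = 1 := by
    rw [← map_mul, ← Units.val_mul, inv_mul_cancel, Units.val_one, map_one]
  exact inv_eq_of_mul_eq_one_right h

open Classical in
/-- **The general indicator sum.**  For `γ ∈ SL₂(ℤ)`, `γ₁ = (1 0; N 1)`, a unit `e` and a constant
`c`: `∑_d χ_L(d)⁻¹ · c · [∃ j, X_j ∈ Γ₀(NM) ∧ d (X_j)₁₁ = e]` equals `χ_L(e)⁻¹ χ(d_γ) c` if `N ∣ c_γ`,
`M ∤ c_γ`, and `0` otherwise (`X_j = γ T^j γ₁⁻¹`; `χ_L` = `χ` raised to level `NM`). [folklore] -/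
theorem sum_indicator (hM : M.Prime) (hMN : M.Coprime N) (χ : DirichletCharacter ℂ N)
    {γ₁ : SL(2, ℤ)} (hγ₁ : (γ₁ : Matrix (Fin 2) (Fin 2) ℤ) = !![1, 0; (N : ℤ), 1])
    (γ : SL(2, ℤ)) (e : (ZMod (N * M))ˣ) (c : ℂ) :
    (∑ d : (ZMod (N * M))ˣ,
        (DirichletCharacter.changeLevel (dvd_mul_right N M) χ (d : ZMod (N * M)))⁻¹ *
          (if ∃ j : ℤ, γ * ModularGroup.T ^ j * γ₁⁻¹ ∈ Gamma0 (N * M) ∧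
              (d : ZMod (N * M)) * (((γ * ModularGroup.T ^ j * γ₁⁻¹) 1 1 : ℤ) : ZMod (N * M)) =
                (e : ZMod (N * M)) then c else 0)) =
      if (N : ℤ) ∣ γ 1 0 ∧ ¬ (M : ℤ) ∣ γ 1 0 then
        (DirichletCharacter.changeLevel (dvd_mul_right N M) χ (e : ZMod (N * M)))⁻¹ *
          χ ((γ 1 1 : ℤ) : ZMod N) * c
      else 0 := by
  classical
  set χL := DirichletCharacter.changeLevel (dvd_mul_right N M) χ with hχL
  split_ifs with hP
  · obtain ⟨j₀, hX₀⟩ := exists_X_mem hM hMN hγ₁ hP.1 hP.2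
    have hu : IsUnit ((((γ * ModularGroup.T ^ j₀ * γ₁⁻¹) 1 1 : ℤ) : ZMod (N * M))) :=
      isUnit_Gamma0Map (N * M) ⟨_, hX₀⟩
    set u : (ZMod (N * M))ˣ := hu.unit with hu_def
    have hcu : (u : ZMod (N * M)) = (((γ * ModularGroup.T ^ j₀ * γ₁⁻¹) 1 1 : ℤ) : ZMod (N * M)) :=
      rfl
    have key : ∀ d : (ZMod (N * M))ˣ,
        (∃ j : ℤ, γ * ModularGroup.T ^ j * γ₁⁻¹ ∈ Gamma0 (N * M) ∧
          (d : ZMod (N * M)) * (((γ * ModularGroup.T ^ j * γ₁⁻¹) 1 1 : ℤ) : ZMod (N * M)) =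
            (e : ZMod (N * M))) ↔ d = e * u⁻¹ := by
      intro d
      constructor
      · rintro ⟨j, hXj, hdj⟩
        rw [X_apply_one_one_eq hM hMN hγ₁ hXj hX₀, ← hcu, ← Units.val_mul] at hdj
        rw [← Units.ext hdj, mul_inv_cancel_right]
      · rintro rfl
        refine ⟨j₀, hX₀, ?_⟩
        rw [← hcu, ← Units.val_mul, inv_mul_cancel_right]
    simp_rw [key, mul_ite, mul_zero]
    rw [Finset.sum_ite_eq' Finset.univ (e * u⁻¹)
      (fun d : (ZMod (N * M))ˣ ↦ (χL (d : ZMod (N * M)))⁻¹ * c), if_pos (Finset.mem_univ _)]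
    -- `χ_L(e u⁻¹)⁻¹ = χ_L(e)⁻¹ χ_L(u)` and `χ_L(u) = χ(d_γ)`
    rw [Units.val_mul, map_mul, mul_inv, dirichlet_apply_inv_units_inv]
    congr 2
    rw [hχL, DirichletCharacter.changeLevel_eq_cast_of_dvd χ (dvd_mul_right N M) u, hcu,
      ZMod.cast_intCast (dvd_mul_right N M), (X_entries γ γ₁ hγ₁ j₀).2]
    obtain ⟨c', hc'⟩ := hP.1
    congr 1
    push_cast
    rw [hc']
    push_cast
    rw [ZMod.natCast_self, zero_mul, zero_mul, zero_add]
  · refine Finset.sum_eq_zero fun d _ ↦ ?_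
    rw [if_neg, mul_zero]
    rintro ⟨j, hXj, -⟩
    exact hP (dvd_and_not_dvd_of_X_mem hM hMN hγ₁ hXj)

end IndicatorSum

/-! ### Constant terms of the `χ`-average -/

section ConstantTerms

variable {N M : ℕ} [NeZero (N * M)] {k : ℤ}

/-- Constant terms of `∑_d χ_L(d)⁻¹ H ∣[k] σ_d` from those of `H`. [folklore] -/
theorem tendsto_average_slash {L : ℕ} [NeZero L] (ψ : DirichletCharacter ℂ L) {H : ℍ → ℂ}
    (σ : (ZMod L)ˣ → Gamma0 L) {V : SL(2, ℤ) → ℂ}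
    (hlim : ∀ g : SL(2, ℤ), Tendsto (H ∣[k] g) atImInfty (𝓝 (V g))) (γ : SL(2, ℤ)) :
    Tendsto ((∑ d : (ZMod L)ˣ, (ψ (d : ZMod L))⁻¹ • (H ∣[k] ((σ d : SL(2, ℤ))))) ∣[k] γ) atImInfty
      (𝓝 (∑ d : (ZMod L)ˣ, (ψ (d : ZMod L))⁻¹ * V ((σ d : SL(2, ℤ)) * γ))) := by
  rw [SlashAction.sum_slash]
  have heq : (∑ d : (ZMod L)ˣ, ((ψ (d : ZMod L))⁻¹ • (H ∣[k] ((σ d : SL(2, ℤ))))) ∣[k] γ) =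
      fun z ↦ ∑ d : (ZMod L)ˣ, (((ψ (d : ZMod L))⁻¹ • (H ∣[k] ((σ d : SL(2, ℤ))))) ∣[k] γ) z := by
    ext z; simp only [Finset.sum_apply]
  rw [heq]
  refine tendsto_finsetSum _ fun d _ ↦ ?_
  rw [ModularForm.SL_smul_slash, ← SlashAction.slash_mul]
  have h := (hlim ((σ d : SL(2, ℤ)) * γ)).const_smul ((ψ (d : ZMod L))⁻¹)
  rwa [smul_eq_mul] at h

open Classical in
/-- **The constant terms of the `χ`-average of an indicator form at the cusp `1/N`.**  With
`γ₁ = (1 0; N 1)` and the indicator values of `Edixhoven1997_exists_integralForm_cuspIndicator`,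
`∑_d χ_L(d)⁻¹ ([∃ j, σ_dγT^jγ₁⁻¹ ∈ Γ₁] + (-1)^k [∃ j, -σ_dγT^jγ₁⁻¹ ∈ Γ₁]) = 2χ(d_γ)` if `N ∣ c_γ`,
`M ∤ c_γ`, and `= 0` otherwise (`χ(-1) = (-1)^k`). [folklore] -/
theorem sum_indicator_total (hM : M.Prime) (hMN : M.Coprime N) (χ : DirichletCharacter ℂ N)
    (hpar : χ (-1) = (-1 : ℂ) ^ k)
    {σ : (ZMod (N * M))ˣ → Gamma0 (N * M)} (hσ : ∀ d, Gamma0Map (N * M) (σ d) = (d : ZMod (N * M)))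
    {γ₁ : SL(2, ℤ)} (hγ₁ : (γ₁ : Matrix (Fin 2) (Fin 2) ℤ) = !![1, 0; (N : ℤ), 1]) (γ : SL(2, ℤ)) :
    (∑ d : (ZMod (N * M))ˣ,
        (DirichletCharacter.changeLevel (dvd_mul_right N M) χ (d : ZMod (N * M)))⁻¹ *
          ((if ∃ j : ℤ, (σ d : SL(2, ℤ)) * γ * ModularGroup.T ^ j * γ₁⁻¹ ∈ Gamma1 (N * M)
              then (1 : ℂ) else 0) +
            (if ∃ j : ℤ, -((σ d : SL(2, ℤ)) * γ * ModularGroup.T ^ j * γ₁⁻¹) ∈ Gamma1 (N * M)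
              then (-1 : ℂ) ^ k else 0))) =
      if (N : ℤ) ∣ γ 1 0 ∧ ¬ (M : ℤ) ∣ γ 1 0 then 2 * χ ((γ 1 1 : ℤ) : ZMod N) else 0 := by
  set χL := DirichletCharacter.changeLevel (dvd_mul_right N M) χ with hχL
  -- rewrite the two memberships through `gamma0_mul_mem_Gamma1_iff`
  have hA : ∀ d : (ZMod (N * M))ˣ,
      (∃ j : ℤ, (σ d : SL(2, ℤ)) * γ * ModularGroup.T ^ j * γ₁⁻¹ ∈ Gamma1 (N * M)) ↔
        ∃ j : ℤ, γ * ModularGroup.T ^ j * γ₁⁻¹ ∈ Gamma0 (N * M) ∧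
          (d : ZMod (N * M)) * (((γ * ModularGroup.T ^ j * γ₁⁻¹) 1 1 : ℤ) : ZMod (N * M)) =
            ((1 : (ZMod (N * M))ˣ) : ZMod (N * M)) := by
    intro d
    refine exists_congr fun j ↦ ?_
    rw [show (σ d : SL(2, ℤ)) * γ * ModularGroup.T ^ j * γ₁⁻¹ =
      (σ d : SL(2, ℤ)) * (γ * ModularGroup.T ^ j * γ₁⁻¹) by group, gamma0_mul_mem_Gamma1_iff, hσ,
      Units.val_one]
  have hB : ∀ d : (ZMod (N * M))ˣ,
      (∃ j : ℤ, -((σ d : SL(2, ℤ)) * γ * ModularGroup.T ^ j * γ₁⁻¹) ∈ Gamma1 (N * M)) ↔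
        ∃ j : ℤ, γ * ModularGroup.T ^ j * γ₁⁻¹ ∈ Gamma0 (N * M) ∧
          (d : ZMod (N * M)) * (((γ * ModularGroup.T ^ j * γ₁⁻¹) 1 1 : ℤ) : ZMod (N * M)) =
            ((-1 : (ZMod (N * M))ˣ) : ZMod (N * M)) := by
    intro d
    refine exists_congr fun j ↦ ?_
    rw [show (σ d : SL(2, ℤ)) * γ * ModularGroup.T ^ j * γ₁⁻¹ =
      (σ d : SL(2, ℤ)) * (γ * ModularGroup.T ^ j * γ₁⁻¹) by group, neg_gamma0_mul_mem_Gamma1_iff, hσ,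
      Units.val_neg, Units.val_one]
  simp_rw [hA, hB, mul_add, Finset.sum_add_distrib]
  rw [sum_indicator hM hMN χ hγ₁ γ 1 1, sum_indicator hM hMN χ hγ₁ γ (-1) ((-1 : ℂ) ^ k)]
  split_ifs with hP
  · rw [Units.val_one, map_one, inv_one, one_mul, mul_one, Units.val_neg, Units.val_one]
    -- `χ_L(-1) = χ(-1) = (-1)^k`, an involution
    have hm1 : χL (-1) = (-1 : ℂ) ^ k := by
      have h := DirichletCharacter.changeLevel_eq_cast_of_dvd χ (dvd_mul_right N M) (-1)
      rw [Units.val_neg, Units.val_one] at h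
      rw [hχL, h, ZMod.cast_neg (dvd_mul_right N M), ZMod.cast_one (dvd_mul_right N M), hpar]
    rw [hm1]
    have h1 : ((-1 : ℂ) ^ k)⁻¹ * χ ((γ 1 1 : ℤ) : ZMod N) * (-1 : ℂ) ^ k = χ ((γ 1 1 : ℤ) : ZMod N) := by
      have hne : ((-1 : ℂ) ^ k) ≠ 0 := zpow_ne_zero k (by norm_num)
      field_simp
    rw [h1]
    ring
  · simp

end ConstantTerms

/-! ### `q`-expansions of linear combinations of modular forms -/

section QExp

variable {L : ℕ} {k : ℤ}

/-- `q`-expansion of a linear combination of modular forms on `Γ₁(L)`. [folklore] -/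
theorem qExpansion_sum_smul {ι' : Type*} (s : Finset ι') (c : ι' → ℂ)
    (G : ι' → ModularForm (Gamma1 L) k) :
    qExpansion 1 (⇑(∑ i ∈ s, c i • G i) : ℍ → ℂ) = ∑ i ∈ s, c i • qExpansion 1 (⇑(G i) : ℍ → ℂ) := by
  classical
  induction s using Finset.induction_on with
  | empty =>
    rw [Finset.sum_empty, Finset.sum_empty, ModularForm.coe_zero, UpperHalfPlane.qExpansion_zero]
  | insert i t hi IH =>
    rw [Finset.sum_insert hi, Finset.sum_insert hi, ModularForm.coe_add,
      ModularForm.qExpansion_add one_pos (HeckeTGamma1.one_mem_strictPeriods_Gamma1 L), ← IH,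
      ModularForm.IsGLPos.coe_smul,
      ModularForm.qExpansion_smul one_pos (HeckeTGamma1.one_mem_strictPeriods_Gamma1 L)]

end QExp

/-! ### The exact-nebentypus cuspidal lift of `E - E(M·)` -/

section Main

variable {p : ℕ} [Fact p.Prime]

open Classical in
set_option maxHeartbeats 800000 in
/-- **Billerey–Menares 2016, the step "`F` is a cuspidal eigenform … `f ∈ S_k(Γ₀(Np), ε₀)`" of the
proof of Thm. 2.2, at every odd prime and with the EXACT nebentypus, from integral forms with an
indicator constant term.**  Hypothesis `hX`: the statement
`Edixhoven1997_exists_integralForm_cuspIndicator` verbatim (Edixhoven 1997, Lemma 1.9 and proof: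
`H¹(X₁(L)_{ℤ_p}, ω^{⊗k}(-cusps)) = 0`, `k ≥ 3`; Katz 1973, §1.6–1.7).  Conclusion: for `p` odd,
`ι : ℚ̄_p ≃ ℂ`, a Dirichlet character `χ` modulo `N` with `χ(-1) = (-1)^k`, `k ≥ 3`, a prime
`M ∤ Np` (`p ∤ N`), if all constant terms of `E = eisensteinLevelRaised N k χ M` lie in `𝔪`, then
some cusp form `f₀ ∈ S_k(NM, χ)` has `aₙ(f₀) ≡ aₙ(E) (mod 𝔪)` for all `n` — namely
`f₀ = E - (c₁/2) ∑_d χ̄(d) H ∣[k] σ_d` (module docstring).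
[cite: BillereyMenares2016, §2, proof of Thm. 2.2 (p. 7)] [cite: Edixhoven1997, Lemma 1.9] -/
theorem exists_cuspForm_nebentypus_congr_eisensteinLevelRaised
    (hX : ∀ (p : ℕ) [Fact p.Prime] (L : ℕ) [NeZero L], ¬ p ∣ L → (L ≠ 1 ∨ 3 < p) →
      ∀ (k : ℤ), 3 ≤ k → ∀ (ι : PadicAlgCl p ≃+* ℂ) (γ₀ : SL(2, ℤ)),
      ∃ H : ModularForm (Gamma1 L) k,
        (∀ σ : SL(2, ℤ), σ ∈ Gamma0 L → ∀ n : ℕ,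
          Valued.v (ι.symm ((qExpansion 1 ((⇑H : ℍ → ℂ) ∣[k] σ)).coeff n)) ≤ 1) ∧
        ∀ γ : SL(2, ℤ), Tendsto ((⇑H : ℍ → ℂ) ∣[k] γ) atImInfty
          (𝓝 ((if ∃ j : ℤ, γ * ModularGroup.T ^ j * γ₀⁻¹ ∈ Gamma1 L then (1 : ℂ) else 0) +
            (if ∃ j : ℤ, -(γ * ModularGroup.T ^ j * γ₀⁻¹) ∈ Gamma1 L then (-1 : ℂ) ^ k else 0))))
    (hp2 : p ≠ 2) (ι : PadicAlgCl p ≃+* ℂ) {N : ℕ} [NeZero N] (χ : DirichletCharacter ℂ N)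
    (k : ℕ) (hk : 3 ≤ k) (M : ℕ) [NeZero M] (hpar : χ (-1) = (-1) ^ k) (hpN : ¬ p ∣ N)
    (hM : M.Prime) (hMN : ¬ M ∣ N) (hMp : M ≠ p)
    (hcusp : ∀ γ : SL(2, ℤ), ∃ c : ℂ,
      Tendsto ((⇑(eisensteinLevelRaised N k χ M hk) : ℍ → ℂ) ∣[(k : ℤ)] γ) atImInfty (𝓝 c) ∧
        Valued.v (ι.symm c) < 1) :
    ∃ f₀ : CuspForm (Gamma1 (N * M)) k,
      f₀ ∈ nebentypusSubspace (N * M) k (DirichletCharacter.changeLevel (dvd_mul_right N M) χ) ∧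
      ∀ n, Valued.v (ι.symm (cuspCoeff f₀ n -
        (qExpansion 1 ⇑(eisensteinLevelRaised N k χ M hk)).coeff n)) < 1 := by
  have hp : p.Prime := Fact.out
  haveI : NeZero (N * M) := ⟨mul_ne_zero (NeZero.ne N) (NeZero.ne M)⟩
  have hMN' : M.Coprime N := (Nat.Prime.coprime_iff_not_dvd hM).2 hMN
  have hpL : ¬ p ∣ N * M := by
    intro h
    rcases (Nat.Prime.dvd_mul hp).1 h with h | h
    · exact hpN h
    · exact hMp ((Nat.prime_dvd_prime_iff_eq hp hM).1 h).symm
  have hL1 : N * M ≠ 1 ∨ 3 < p := Or.inl fun h ↦ hM.one_lt.ne' (Nat.eq_one_of_mul_eq_one_left h)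
  -- ### norms versus valuations
  have hvlt : ∀ x : PadicAlgCl p, Valued.v x < 1 ↔ ‖x‖ < 1 := fun x ↦ by
    rw [PadicAlgCl.valuation_def, ← NNReal.coe_lt_coe, coe_nnnorm, NNReal.coe_one]
  have hvle : ∀ x : PadicAlgCl p, Valued.v x ≤ 1 ↔ ‖x‖ ≤ 1 := fun x ↦ by
    rw [PadicAlgCl.valuation_def, ← NNReal.coe_le_coe, coe_nnnorm, NNReal.coe_one]
  -- ### `γ₁ = (1 0; N 1)` and the form `H` of `hX` at the cusp `1/N`
  have hdet : Matrix.det !![(1 : ℤ), 0; (N : ℤ), 1] = 1 := by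
    rw [Matrix.det_fin_two_of]; ring
  set γ₁ : SL(2, ℤ) := ⟨!![(1 : ℤ), 0; (N : ℤ), 1], hdet⟩ with hγ₁def
  have hγ₁ : (γ₁ : Matrix (Fin 2) (Fin 2) ℤ) = !![1, 0; (N : ℤ), 1] := rfl
  obtain ⟨H, hint, hlim⟩ := hX p (N * M) hpL hL1 (k : ℤ) (by exact_mod_cast hk) ι γ₁
  -- ### `σ_d`, `χ_L`, the average `H_χ`
  choose σ hσ using fun d : (ZMod (N * M))ˣ ↦ exists_gamma0Map_eq_holds (N * M) d.isUnit
  set χL := DirichletCharacter.changeLevel (dvd_mul_right N M) χ with hχL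
  choose G hG using fun d : (ZMod (N * M))ˣ ↦ exists_modularForm_coe_eq_slash H (σ d)
  set Hχ : ModularForm (Gamma1 (N * M)) k := ∑ d : (ZMod (N * M))ˣ, (χL (d : ZMod (N * M)))⁻¹ • G d
    with hHχdef
  have hHχ : (⇑Hχ : ℍ → ℂ) =
      ∑ d : (ZMod (N * M))ˣ, (χL (d : ZMod (N * M)))⁻¹ • ((⇑H : ℍ → ℂ) ∣[(k : ℤ)] ((σ d : SL(2, ℤ)))) := by
    change ModularForm.coeHom Hχ = _
    rw [hHχdef, map_sum]
    refine Finset.sum_congr rfl fun d _ ↦ ?_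
    change (⇑((χL (d : ZMod (N * M)))⁻¹ • G d) : ℍ → ℂ) = _
    rw [ModularForm.IsGLPos.coe_smul, hG]
  set E := eisensteinLevelRaised N k χ M hk with hE
  -- ### constant terms of `E`
  set c₁ : ℂ := (-(Literature.NumberTheory.LFunctions.generalizedBernoulli k χ) / (4 * k)) *
    ((1 + χ (-1) * (-1) ^ (k : ℤ)) * (1 - χ⁻¹ (M : ZMod N) * (M : ℂ) ^ (-(k : ℤ)))) with hc₁
  have hEct : ∀ γ : SL(2, ℤ), Tendsto ((⇑E : ℍ → ℂ) ∣[(k : ℤ)] γ) atImInfty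
      (𝓝 (if (N : ℤ) ∣ γ 1 0 ∧ ¬ (M : ℤ) ∣ γ 1 0 then c₁ * χ ((γ 1 1 : ℤ) : ZMod N) else 0)) := by
    intro γ
    by_cases hMc : (M : ℤ) ∣ γ 1 0
    · rw [if_neg fun h ↦ h.2 hMc]
      exact tendsto_eisensteinLevelRaised_slash_atImInfty_of_dvd k χ M hk hMN' hMc
    · have hprime : Prime (M : ℤ) := Nat.prime_iff_prime_int.mp hM
      have hcop : IsCoprime (γ 1 0) (M : ℤ) :=
        ((Irreducible.coprime_iff_not_dvd hprime.irreducible).2 hMc).symm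
      have h := tendsto_eisensteinLevelRaised_slash_atImInfty_of_isCoprime k χ M hk hMN' hcop
      by_cases hNc : (N : ℤ) ∣ γ 1 0
      · rw [if_pos ⟨hNc, hMc⟩]
        rw [if_pos ((ZMod.intCast_zmod_eq_zero_iff_dvd _ _).2 hNc)] at h
        convert h using 2
        rw [hc₁]; ring
      · rw [if_neg fun h' ↦ hNc h'.1]
        rwa [if_neg fun h' ↦ hNc ((ZMod.intCast_zmod_eq_zero_iff_dvd _ _).1 h'), mul_zero] at h
  -- ### `c₁ ∈ 𝔪` (the constant term at `γ₁`)
  have hc₁v : ‖ι.symm c₁‖ < 1 := by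
    obtain ⟨c, hc, hcv⟩ := hcusp γ₁
    have h1 := hEct γ₁
    have h10 : (γ₁ 1 0 : ℤ) = N := by simp [hγ₁def]
    have h11 : (γ₁ 1 1 : ℤ) = 1 := by simp [hγ₁def]
    have hP1 : (N : ℤ) ∣ γ₁ 1 0 ∧ ¬ (M : ℤ) ∣ γ₁ 1 0 := by
      rw [h10]
      exact ⟨dvd_rfl, fun h ↦ hMN (Int.natCast_dvd_natCast.mp h)⟩
    rw [if_pos hP1, h11, Int.cast_one, map_one, mul_one] at h1
    rw [tendsto_nhds_unique hc h1] at hcv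
    exact (hvlt _).mp hcv
  -- ### constant terms of `H_χ`
  have hpar' : χ (-1) = (-1 : ℂ) ^ (k : ℤ) := by rw [zpow_natCast]; exact hpar
  have hHct : ∀ γ : SL(2, ℤ), Tendsto ((⇑Hχ : ℍ → ℂ) ∣[(k : ℤ)] γ) atImInfty
      (𝓝 (if (N : ℤ) ∣ γ 1 0 ∧ ¬ (M : ℤ) ∣ γ 1 0 then 2 * χ ((γ 1 1 : ℤ) : ZMod N) else 0)) := by
    intro γ
    rw [hHχ, ← sum_indicator_total hM hMN' χ hpar' hσ hγ₁ γ]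
    exact tendsto_average_slash χL σ hlim γ
  -- ### `F = E - (c₁/2) H_χ` has vanishing constant terms
  set F : ModularForm (Gamma1 (N * M)) k := E - (c₁ / 2) • Hχ with hFdef
  have hFcoe : (⇑F : ℍ → ℂ) = ⇑E - (c₁ / 2) • ⇑Hχ := by
    rw [hFdef, ModularForm.coe_sub, ModularForm.IsGLPos.coe_smul]
  have hFct : ∀ γ : SL(2, ℤ), Tendsto ((⇑F : ℍ → ℂ) ∣[(k : ℤ)] γ) atImInfty (𝓝 0) := by
    intro γ
    rw [hFcoe, sub_smul_slash_SL2]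
    have h := (hEct γ).sub ((hHct γ).const_smul (c₁ / 2))
    have h0 : (if (N : ℤ) ∣ γ 1 0 ∧ ¬ (M : ℤ) ∣ γ 1 0 then c₁ * χ ((γ 1 1 : ℤ) : ZMod N) else 0) -
        (c₁ / 2) • (if (N : ℤ) ∣ γ 1 0 ∧ ¬ (M : ℤ) ∣ γ 1 0 then 2 * χ ((γ 1 1 : ℤ) : ZMod N)
          else 0) = 0 := by
      split_ifs
      · rw [smul_eq_mul]; ring
      · simp
    rwa [h0] at h
  -- ### the cusp form `f₀`
  let f₀ : CuspForm (Gamma1 (N * M)) k :=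
    { toFun := ⇑F
      slash_action_eq' := F.slash_action_eq'
      holo' := F.holo'
      zero_at_cusps' := fun {c} hc ↦ by
        rw [Subgroup.IsArithmetic.isCusp_iff_isCusp_SL2Z] at hc
        rw [OnePoint.isZeroAt_iff_forall_SL2Z hc]
        intro γ _
        have h := hFct γ
        rw [ModularForm.SL_slash] at h
        exact h }
  have hcoe : (⇑f₀ : ℍ → ℂ) = ⇑F := rfl
  -- ### `χ_L` on `Γ₀(NM)` is `χ(d_γ)`
  have hχLγ : ∀ γ : Gamma0 (N * M),
      χL (Gamma0Map (N * M) γ) = χ ((((γ : SL(2, ℤ)) 1 1 : ℤ)) : ZMod N) := by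
    intro γ
    have hcop : IsCoprime (((γ : SL(2, ℤ)) 1 1 : ℤ)) ((N * M : ℕ) : ℤ) := by
      have hdet' := Matrix.SpecialLinearGroup.det_coe (γ : SL(2, ℤ))
      rw [Matrix.det_fin_two] at hdet'
      have hc : ((N * M : ℕ) : ℤ) ∣ (γ : SL(2, ℤ)) 1 0 := by
        have h0 := Gamma0_mem.mp γ.2
        rwa [ZMod.intCast_zmod_eq_zero_iff_dvd] at h0
      obtain ⟨e, he⟩ := hc
      refine ⟨(γ : SL(2, ℤ)) 0 0, -((γ : SL(2, ℤ)) 0 1 * e), ?_⟩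
      linear_combination hdet' + ((γ : SL(2, ℤ)) 0 1) * he
    have h := DirichletCharacter.changeLevel_eq_cast_of_dvd' χ (dvd_mul_right N M) hcop
    rw [hχL]
    exact h
  refine ⟨f₀, ?_, fun n ↦ ?_⟩
  · -- ### nebentypus `χ_L`
    refine mem_nebentypusSubspace_of_forall_slash fun γ ↦ ?_
    change (⇑F : ℍ → ℂ) ∣[(k : ℤ)] ((γ : SL(2, ℤ)) : GL (Fin 2) ℝ) = χL (Gamma0Map (N * M) γ) • ⇑F
    rw [← ModularForm.SL_slash, hFcoe, sub_smul_slash_SL2,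
      eisensteinLevelRaised_slash_of_mem_gamma0 k χ M hk γ.2, hHχ, average_slash χL H hσ γ, hχLγ,
      smul_sub, smul_comm]
  · -- ### the congruence `aₙ(f₀) - aₙ(E) = -(c₁/2) aₙ(H_χ) ∈ 𝔪`
    have hq : qExpansion 1 (⇑f₀ : ℍ → ℂ) =
        qExpansion 1 (⇑E : ℍ → ℂ) - (c₁ / 2) • qExpansion 1 (⇑Hχ : ℍ → ℂ) := by
      rw [hcoe, hFdef, ModularForm.coe_sub,
        ModularForm.qExpansion_sub one_pos (HeckeTGamma1.one_mem_strictPeriods_Gamma1 (N * M)) E ((c₁ / 2) • Hχ),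
        ModularForm.IsGLPos.coe_smul,
        ModularForm.qExpansion_smul one_pos (HeckeTGamma1.one_mem_strictPeriods_Gamma1 (N * M))]
    have hqH : qExpansion 1 (⇑Hχ : ℍ → ℂ) =
        ∑ d : (ZMod (N * M))ˣ, (χL (d : ZMod (N * M)))⁻¹ • qExpansion 1 (⇑(G d) : ℍ → ℂ) := by
      rw [hHχdef]; exact qExpansion_sum_smul _ _ _
    have hdiff : (PowerSeries.coeff n) (qExpansion 1 (⇑E : ℍ → ℂ) -
        (c₁ / 2) • qExpansion 1 (⇑Hχ : ℍ → ℂ)) - (PowerSeries.coeff n) (qExpansion 1 (⇑E : ℍ → ℂ)) =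
        -((c₁ / 2) * ∑ d : (ZMod (N * M))ˣ,
          (χL (d : ZMod (N * M)))⁻¹ * (PowerSeries.coeff n) (qExpansion 1 (⇑(G d) : ℍ → ℂ))) := by
      rw [map_sub, PowerSeries.coeff_smul, smul_eq_mul, hqH, map_sum]
      simp only [PowerSeries.coeff_smul, smul_eq_mul]
      ring
    rw [cuspCoeff, hq, hdiff, map_neg, Valuation.map_neg, map_mul, Valuation.map_mul]
    -- `v(c₁/2) < 1` and the sum is integral
    have h2 : Valued.v (ι.symm (c₁ / 2)) < 1 := by
      rw [hvlt, map_div₀, map_ofNat, norm_div]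
      have h2n : ‖((2 : ℕ) : PadicAlgCl p)‖ = 1 :=
        Literature.NumberTheory.GaloisRepresentations.PadicAlgCl.norm_natCast_of_not_dvd
          fun h ↦ hp2 ((Nat.prime_dvd_prime_iff_eq hp Nat.prime_two).1 h)
      rw [Nat.cast_ofNat] at h2n
      rw [h2n, div_one]
      exact hc₁v
    have hsum : Valued.v (ι.symm (∑ d : (ZMod (N * M))ˣ,
        (χL (d : ZMod (N * M)))⁻¹ * (PowerSeries.coeff n) (qExpansion 1 (⇑(G d) : ℍ → ℂ)))) ≤ 1 := by
      rw [map_sum]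
      refine Valuation.map_sum_le _ fun d _ ↦ ?_
      rw [map_mul, Valuation.map_mul]
      refine mul_le_one' ?_ ?_
      · -- `χ_L(d)⁻¹ = χ_L(d⁻¹)` is integral
        rw [← dirichlet_apply_inv_units_inv χL d, inv_inv]
        exact valuation_ringEquiv_symm_apply_le_one χL ι _
      · rw [hG]
        exact hint _ (σ d).2 n
    calc Valued.v (ι.symm (c₁ / 2)) * Valued.v (ι.symm (∑ d : (ZMod (N * M))ˣ,
          (χL (d : ZMod (N * M)))⁻¹ * (PowerSeries.coeff n) (qExpansion 1 (⇑(G d) : ℍ → ℂ))))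
        ≤ Valued.v (ι.symm (c₁ / 2)) * 1 := mul_le_mul' le_rfl hsum
      _ < 1 := by rw [mul_one]; exact h2

end Main

end CuspFormLift

end Literature.NumberTheory.EllipticCurves.ModularForms

/-! ### Billerey–Menares 2016, Thm. 2.2 from integral forms with an indicator constant term -/

namespace Literature.NumberTheory.EllipticCurves

open Literature.NumberTheory.EllipticCurves.ModularForms

open Classical in
/-- **Billerey–Menares 2016, Thm. 2.2 at every odd prime, from integral modular forms with an
indicator constant term.**  The hypothesis `hX` is the statement
`Edixhoven1997_exists_integralForm_cuspIndicator` verbatim (B. Edixhoven, in Cornell–Silverman–Stevens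
1997, Lemma 1.9 and its proof: `H¹(X₁(L)_{ℤ_p}, ω^{⊗k}(-cusps)) = 0` for `k ≥ 3`, so that the
constant-term map `M_k(Γ₁(L); 𝒪) → ⊕_{cusps} 𝒪` is onto; Katz 1973, §1.6–1.7); the conclusion is
the named fact `BillereyMenares2016_thm22_exists_newform_odd` (all odd `p`, including `p = 3` and
`p ∣ φ(NM)`: the exact-nebentypus lift `exists_cuspForm_nebentypus_congr_eisensteinLevelRaised`
needs no Carayol lemma), assembled by `BillereyMenares2016_thm22_exists_newform_odd_of_cuspidalCongruence`.
[cite: BillereyMenares2016, §2, Thm. 2.2 (p. 7); Prop. 1.2] [cite: Edixhoven1997, Lemma 1.9]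
[cite: DeligneSerreASENS1974, Lemme 6.11] -/
theorem BillereyMenares2016_thm22_exists_newform_odd_of_integralCuspIndicator
    (hX : ∀ (p : ℕ) [Fact p.Prime] (L : ℕ) [NeZero L], ¬ p ∣ L → (L ≠ 1 ∨ 3 < p) →
      ∀ (k : ℤ), 3 ≤ k → ∀ (ι : PadicAlgCl p ≃+* ℂ) (γ₀ : SL(2, ℤ)),
      ∃ H : ModularForm (Gamma1 L) k,
        (∀ σ : SL(2, ℤ), σ ∈ Gamma0 L → ∀ n : ℕ,
          Valued.v (ι.symm ((qExpansion 1 ((⇑H : ℍ → ℂ) ∣[k] σ)).coeff n)) ≤ 1) ∧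
        ∀ γ : SL(2, ℤ), Tendsto ((⇑H : ℍ → ℂ) ∣[k] γ) atImInfty
          (𝓝 ((if ∃ j : ℤ, γ * ModularGroup.T ^ j * γ₀⁻¹ ∈ Gamma1 L then (1 : ℂ) else 0) +
            (if ∃ j : ℤ, -(γ * ModularGroup.T ^ j * γ₀⁻¹) ∈ Gamma1 L then (-1 : ℂ) ^ k else 0)))) :
    BillereyMenares2016_thm22_exists_newform_odd :=
  BillereyMenares2016_thm22_exists_newform_odd_of_cuspidalCongruence
    fun _ _ ι _ _ χ k hk M _ hp2 _ hpar hpN hM hMN hMp _ _ _ hcusp ↦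
      CuspFormLift.exists_cuspForm_nebentypus_congr_eisensteinLevelRaised hX hp2 ι χ k hk M hpar hpN
        hM hMN hMp hcusp

open Classical in
/-- **Billerey–Menares 2016, Thm. 2.2 for `p ≥ 5` (the named fact
`BillereyMenares2016_thm22_exists_newform`) from the same hypothesis**, through
`BillereyMenares2016_thm22_exists_newform_of_odd`. [cite: BillereyMenares2016, §2, Thm. 2.2 (p. 7); Prop. 1.2]
[cite: Edixhoven1997, Lemma 1.9] -/
theorem BillereyMenares2016_thm22_exists_newform_of_integralCuspIndicator
    (hX : ∀ (p : ℕ) [Fact p.Prime] (L : ℕ) [NeZero L], ¬ p ∣ L → (L ≠ 1 ∨ 3 < p) →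
      ∀ (k : ℤ), 3 ≤ k → ∀ (ι : PadicAlgCl p ≃+* ℂ) (γ₀ : SL(2, ℤ)),
      ∃ H : ModularForm (Gamma1 L) k,
        (∀ σ : SL(2, ℤ), σ ∈ Gamma0 L → ∀ n : ℕ,
          Valued.v (ι.symm ((qExpansion 1 ((⇑H : ℍ → ℂ) ∣[k] σ)).coeff n)) ≤ 1) ∧
        ∀ γ : SL(2, ℤ), Tendsto ((⇑H : ℍ → ℂ) ∣[k] γ) atImInfty
          (𝓝 ((if ∃ j : ℤ, γ * ModularGroup.T ^ j * γ₀⁻¹ ∈ Gamma1 L then (1 : ℂ) else 0) +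
            (if ∃ j : ℤ, -(γ * ModularGroup.T ^ j * γ₀⁻¹) ∈ Gamma1 L then (-1 : ℂ) ^ k else 0)))) :
    BillereyMenares2016_thm22_exists_newform :=
  BillereyMenares2016_thm22_exists_newform_of_odd
    (BillereyMenares2016_thm22_exists_newform_odd_of_integralCuspIndicator hX)

end Literature.NumberTheory.EllipticCurves
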